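import Summits.BirchSwinnertonDyer.BirchSwinnertonDyer.Theorems.PrintCf2RamifiedOffTYZGenusPeriodR2
import HarnessLib

/-!
# C⁺ on the two-prime sector R2 from THREE EXPLICIT SYMBOL LAWS — the «depth Z = [X(h) ∈ 2ℚ^{×2}]» sentence of cycle 27 splits into a
# CM-side law and a descent-side law, each with an explicit Rédei / 8-rank right-hand side (crux stmt-BirchSwinnertonDyer-20509
# `RamifiedOffTYZOfFacts`, line `offtyz-v7`, LEAD cruxlead-20509 g27, lineage cycle 28)

HONEST FRAMING (cell `bsd-print-cf2`, route `PrintCf2`; `--supports stmt-BirchSwinnertonDyer-20509`; theorems only, `def`-free, no named fact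
introduced, no `sorry`).  BSD is not proved by any of this; no class is closed by this file; item 23431 (C⁺) and crux 20509 stay OPEN.  The three
laws below enter as HYPOTHESES (binders); what is proved is the composition «laws ⟹ C⁺» by pure logic over the cycle-27 kernel
(`GenusPeriodR2.levelTwo_iff_genusPeriod_R2`, `…_R2_delta`, p789339).

THE FINDING OF CYCLE 28 (instrument, exact arithmetic; evidence on item 20509: `r2laws.py`, `r2predict.py`, `REDEI-LAWS-R2-g27.md`).  On
R2 = {n = lq : l ≡ 1, q ≡ 7 (mod 8) primes, (l/q) = 1} consider three classical depth-two invariants of the pair (l, q):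
* `δ(l)` — the tree's rank-zero digit of the block `l`: `ord_{s=1} L(E_l, s) = 0 ∧ #Sel₄(E_l) = 2⁴` (⟺ `𝓛(l) ≡ 2 (mod 4)`; by [Wang2016CongruentSha,
  Thm. 3] ⟺ `l ≠ x² + 32y²` ⟺ `8 ∤ h(ℚ(√−l))`);
* `S(l,q)` — the Rédei-type symbol `[2, l, q] = +1`: writing `l = a² − 2b²` with `a > 0` and `r² ≡ 2 (mod q)`, `a + b·r` is a square mod `q`
  (numerically, 315/315 pairs: ⟺ the class of a prime above `2` in `Cl(ℚ(√−lq))` is a FOURTH power; and `[2,l,q]·[2,q,l] = +1 ⟺ l = x² + 32y²`);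
* `T(l,q)` — `q` is a fourth power mod `l`, i.e. `(q/l)₄ = +1` (⟺ `8 ∣ h(ℚ(√−lq))`).
g17's exact-arithmetic census of the line (122 rows `n ≤ 2·10⁴` with `ord_{s=1} L(E_n, s) = 1`; depth of the genus period `Z(n)` in `A(ℍ′_n)/tors`,
the `A_n(ℚ)`-generator's class, `ρ(n)`, `v₂(𝓛(n))`) falls into the eight cells of `(δ, S, T)` with EVERY observable constant on each cell:
`δ` → (ρ = 1, depth Z = 0, v₂𝓛 = 1; 78 rows); `¬δ ∧ ¬S` → (ρ = 0, generator visible, depth Z = 0, v₂𝓛 = 1; 27); `¬δ ∧ S ∧ ¬T` → (ρ = 0, generator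
INVISIBLE `X ∈ 2ℚ^{×2}`, depth Z = 1, v₂𝓛 = 1; 12); `¬δ ∧ S ∧ T` → (v₂𝓛 = 2: NOT a jump-one row; 5).  Hence the empirical laws, 122/122:
  LAW Z  «Z(lq) ∈ 2A(ℍ′) + tors ⟺ ¬δ(l) ∧ S(l,q)», and then Z(lq) ∉ 4A(ℍ′) + tors;   LAW V  «X(h) ∈ 2ℚ^{×2} ⟺ ¬δ(l) ∧ S(l,q) ∧ ¬T(l,q)»;
  LAW S  «#Sel₂(E_{lq}) = 2⁵ ∧ #Sel₄(E_{lq}) = 2⁶ ⟹ ¬(¬δ(l) ∧ S(l,q) ∧ T(l,q))».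
LAW Z was then TESTED OUT OF SAMPLE: 47/47 fresh rows `2·10⁴ < n < 4·10⁴` (21 predicted `2`-divisible, 26 predicted not; 0 mismatches; g17's
`zperiod.py`).  LAW Z is the CM-side statement the U-road must prove (its right-hand side is now explicit); LAW V / LAW S are second-descent statements
(Cassels–Tate pairing on `Sel^{(φ)}(A_{lq})`, the rank-one analogue of [Wang2016CongruentSha, Thm. 1]); none of the three is in print.

CONTENTS.  §1 `exists_atwo_generator` (a generator of `A_n(ℚ)` modulo torsion in coordinates, granted GZK).  §2 ★ `levelTwo_R2_of_cellLaws`: for ANY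
propositions `S T`, the pointwise laws Z and V at a row `n = lq` (read on any display package and any generator) imply C⁺ at `n` whenever the row is
outside the cell `¬δ ∧ S ∧ T` — both `δ`-branches of the cycle-27 iff are discharged by the laws, by cases.  §3 ★★ `levelTwo_R2_of_redeiLaws`: the
same with `S, T` the EXPLICIT symbols above (spelled inline).  §4 ★★ `levelTwoScriptLExact_R2_of_laws_of_bundle`: 𝔅_ram VERBATIM + the display fact
`tyz_genusPointBlockData` + the three laws quantified over R2 ⟹ item 23431's statement for every `n = lq` on R2 (the `#Sel` binders of 23431 enter only
through LAW S).

References: [cite: TianYuanZhang2017, §3.1 (p0011 L27–L73), Thm. 3.5, Lemma 3.18, Thm. 1.2]; [cite: Wang2016CongruentSha, Thm. 1, Thm. 3 (arXiv:1511.03810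
p0003, p0011)]; [cite: Darmon2004, Thm. 3.22] (GZK); [cite: BurungaleFlach2024, Thm 1.1 / Cor. 3]; tree: g26 `…GenusPeriodR2` (p789339), `…TwoPrimesByName`
(p788929), g19 `…LevelTwoGenusPoint`, `TianYuanZhang2017.W2.stub_S0'`.
-/

noncomputable section

open scoped Classical

open WeierstrassCurve WeierstrassCurve.Affine WeierstrassCurve.Affine.Point
  Literature.NumberTheory.EllipticCurves Literature.NumberTheory.EllipticCurves.Rank1Residual
  Summit.BirchSwinnertonDyer.Rank1Residual
  Literature.NumberTheory.EllipticCurves.TianYuanZhang2017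
  Literature.NumberTheory.EllipticCurves.TianYuanZhang2017.W2
  Summit.BirchSwinnertonDyer.PrintCf2.RankZeroDigitDepthTwo
  Summit.BirchSwinnertonDyer.PrintCf2.TwoPrimesByName
  Summit.BirchSwinnertonDyer.PrintCf2.GenusPeriodR2

set_option autoImplicit false

namespace Summit.BirchSwinnertonDyer.PrintCf2.RedeiCellsR2

variable {n : ℕ}

/-! ## §1 A generator of `A_n(ℚ)` modulo torsion, in coordinates -/

/-- **A coordinate generator of `A_n(ℚ)/tors`** (granted GZK): for square-free `n` with `ord_{s=1} L(E_n, s) = 1`, some affine point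
`h = (X, Y) ∈ A_n(ℚ)` generates `A_n(ℚ)` modulo torsion (`rank A_n(ℚ) = rank E_n(ℚ) = 1` by isogeny invariance and GZK; `W2.stub_S0'`
gives a generator, which is not `O` because a non-torsion point exists). [cite: TianYuanZhang2017, §3.1 (chunk p0011 L27–L36)] [cite: Darmon2004, Thm. 3.22] -/
theorem exists_atwo_generator (hGZK : rank_eq_analyticRank_of_analyticRank_le_one) (hsq : Squarefree n)
    (hr : (congruentNumberCurve n).analyticRank = 1) :
    ∃ (X Y : ℚ) (h : (Atwo n).toAffine.Nonsingular X Y),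
      ∀ P : (Atwo n).toAffine.Point, ∃ m : ℤ, IsOfFinAddOrder (P - m • (Point.some X Y h : (Atwo n).toAffine.Point)) := by
  haveI := isElliptic_congruentNumberCurve hsq.ne_zero
  have hrank : (congruentNumberCurve n).mordellWeilRank = 1 := (hGZK _ hr.le).1.trans hr
  obtain ⟨α₀, hα₀⟩ := stub_S0' (n := n) hrank.le
  have hrank2 : 1 ≤ (Atwo n).mordellWeilRank := by
    rw [← (congruentNumberCurve n).twoIsogeny.mordellWeilRank_eq, hrank]
  obtain ⟨x, hx⟩ := LevelTwo.exists_not_isOfFinAddOrder_of_one_le_rank (Atwo n) hrank2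
  have hα₀nt : ¬ IsOfFinAddOrder α₀ := LevelTwo.not_isOfFinAddOrder_of_generates hx (hα₀ x)
  rcases α₀ with _ | ⟨X, Y, h⟩
  · exact absurd IsOfFinAddOrder.zero hα₀nt
  · exact ⟨X, Y, h, hα₀⟩

/-! ## §2 The cell composition, abstract in the two symbols -/

/-- ★ **C⁺ at a row of R2 from the pointwise laws Z and V, off the cell `¬δ(l) ∧ S ∧ T`** (granted GZK, modularity, CM rank-zero BSD, TYZ Thm 1.2′,
read on any display package `D` and any generator `h = (X, Y)` of `A_n(ℚ)/tors`).  For ANY propositions `S, T`: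
if «`Z(lq) ∈ 2A(ℍ′)+tors ⟺ ¬δ(l) ∧ S`» (LAW Z), «then `Z(lq) ∉ 4A(ℍ′)+tors`» (LAW Z, exact depth), and «`X ∈ 2ℚ^{×2} ⟺ ¬δ(l) ∧ S ∧ ¬T`» (LAW V)
hold at this row, and the row is not in the cell `¬δ(l) ∧ S ∧ T`, then every integer `L` with `𝓛(lq)² = L²` has `2 ∥ L`.  Proof: by cases on `δ(l)`;
on `¬δ(l)` the cycle-27 iff `levelTwo_iff_genusPeriod_R2` is fed the invisible branch (if `S`) or the visible branch (if `¬S`); on `δ(l)` the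
`α_q`-shifted iff `levelTwo_iff_genusPeriod_R2_delta` is fed its visible branch (both laws have FALSE right-hand sides there).
[cite: TianYuanZhang2017, §3.1, Thm. 3.5, Lemma 3.18] [cite: Darmon2004, Thm. 3.22] [cite: BurungaleFlach2024, Thm 1.1 / Cor. 3] -/
theorem levelTwo_R2_of_cellLaws (hGZK : rank_eq_analyticRank_of_analyticRank_le_one)
    (hmod : WeierstrassCurve.hasEntireLFunction_rat) (hCM0 : bsdTriple_of_hasCM_of_L_one_ne_zero) (h12 : thm12_parity_of_scriptL')
    {l q : ℕ} (hl : l.Prime) (hq : q.Prime) (hl8 : l % 8 = 1) (hq8 : q % 8 = 7) (hn : n = l * q)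
    (hr : (congruentNumberCurve n).analyticRank = 1)
    (D : GenusPointData n) (hPr : D.Printed) (hC : D.CMPointCompositumPrinted) (hBl : D.Thm35AtBlocks)
    {X Y : ℚ} (h : (Atwo n).toAffine.Nonsingular X Y)
    (hgen : ∀ P : (Atwo n).toAffine.Point, ∃ m : ℤ, IsOfFinAddOrder (P - m • (Point.some X Y h : (Atwo n).toAffine.Point)))
    {S T : Prop}
    (hZ : (∃ y : APoint D.H, IsOfFinAddOrder (D.Z n - (2 : ℤ) • y)) ↔
      (¬ ((congruentNumberCurve l).analyticRank = 0 ∧ Nat.card ((congruentNumberCurve l).selmerGroup 4) = 2 ^ 4) ∧ S))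
    (hZ4 : ¬ ((congruentNumberCurve l).analyticRank = 0 ∧ Nat.card ((congruentNumberCurve l).selmerGroup 4) = 2 ^ 4) → S →
      ¬ ∃ y : APoint D.H, IsOfFinAddOrder (D.Z n - (4 : ℤ) • y))
    (hV : (∃ s : ℚ, X = 2 * s ^ 2) ↔
      (¬ ((congruentNumberCurve l).analyticRank = 0 ∧ Nat.card ((congruentNumberCurve l).selmerGroup 4) = 2 ^ 4) ∧ S ∧ ¬ T))
    (hcell : ¬ (¬ ((congruentNumberCurve l).analyticRank = 0 ∧ Nat.card ((congruentNumberCurve l).selmerGroup 4) = 2 ^ 4) ∧ S ∧ T)) :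
    ∀ L : ℤ, IsScriptL n L → (2 : ℤ) ∣ L ∧ ¬ (4 : ℤ) ∣ L := by
  by_cases hδ : ((congruentNumberCurve l).analyticRank = 0 ∧ Nat.card ((congruentNumberCurve l).selmerGroup 4) = 2 ^ 4)
  · -- partner rows: both laws have false right-hand sides; the visible branch of the `δ`-iff
    obtain ⟨α, hα, -⟩ := exists_generatesFreePart_prime hGZK h12 hq (Or.inr hq8)
    refine (levelTwo_iff_genusPeriod_R2_delta hGZK hmod hCM0 h12 hl hq hl8 hq8 hn hr D hPr hC hBl h hgen α hα hδ).mpr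
      (Or.inr ⟨?_, ?_⟩)
    · intro hX; exact (hV.mp hX).1 hδ
    · intro h2; exact (hZ.mp h2).1 hδ
  · by_cases hS : S
    · -- invisible branch
      have hT : ¬ T := fun hT => hcell ⟨hδ, hS, hT⟩
      exact (levelTwo_iff_genusPeriod_R2 hGZK hmod hCM0 h12 hl hq hl8 hq8 hn hr D hPr hC hBl h hgen hδ).mpr
        (Or.inl ⟨hV.mpr ⟨hδ, hS, hT⟩, hZ.mpr ⟨hδ, hS⟩, hZ4 hδ hS⟩)
    · -- visible branch
      exact (levelTwo_iff_genusPeriod_R2 hGZK hmod hCM0 h12 hl hq hl8 hq8 hn hr D hPr hC hBl h hgen hδ).mpr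
        (Or.inr ⟨fun hX => hS (hV.mp hX).2.1, fun h2 => hS (hZ.mp h2).2⟩)

/-! ## §3 The same with the explicit symbols `[2, l, q]` and `(q/l)₄` -/

/-- ★★ **C⁺ at a row of R2 from the EXPLICIT Rédei laws.**  `S(l,q)` := «for all `a, b, r ∈ ℤ` with `l = a² − 2b²`, `a > 0`, `r² = 2` in `ℤ/q`:
`a + b r` is a square in `ℤ/q`» (the symbol `[2, l, q] = +1`; all such `(a, b, r)` give the same value); `T(l,q)` := «`q` is a fourth power in `ℤ/l`»
(`(q/l)₄ = +1`).  Granted GZK, modularity, CM rank-zero BSD, TYZ Thm 1.2′, a display package and a generator: LAW Z + LAW V at the row, and the row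
outside the cell `¬δ(l) ∧ [2,l,q] = +1 ∧ (q/l)₄ = +1`, give `2 ∥ 𝓛(lq)`.  (Census: this cell is exactly where `v₂(𝓛(lq)) = 2`, 5/122 rows, none jump-one.)
[cite: TianYuanZhang2017, §3.1, Thm. 3.5] [cite: Wang2016CongruentSha, Thm. 3] [cite: Darmon2004, Thm. 3.22] -/
theorem levelTwo_R2_of_redeiLaws (hGZK : rank_eq_analyticRank_of_analyticRank_le_one)
    (hmod : WeierstrassCurve.hasEntireLFunction_rat) (hCM0 : bsdTriple_of_hasCM_of_L_one_ne_zero) (h12 : thm12_parity_of_scriptL')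
    {l q : ℕ} (hl : l.Prime) (hq : q.Prime) (hl8 : l % 8 = 1) (hq8 : q % 8 = 7) (hn : n = l * q)
    (hr : (congruentNumberCurve n).analyticRank = 1)
    (D : GenusPointData n) (hPr : D.Printed) (hC : D.CMPointCompositumPrinted) (hBl : D.Thm35AtBlocks)
    {X Y : ℚ} (h : (Atwo n).toAffine.Nonsingular X Y)
    (hgen : ∀ P : (Atwo n).toAffine.Point, ∃ m : ℤ, IsOfFinAddOrder (P - m • (Point.some X Y h : (Atwo n).toAffine.Point)))
    (hZ : (∃ y : APoint D.H, IsOfFinAddOrder (D.Z n - (2 : ℤ) • y)) ↔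
      (¬ ((congruentNumberCurve l).analyticRank = 0 ∧ Nat.card ((congruentNumberCurve l).selmerGroup 4) = 2 ^ 4) ∧
        (∀ a b r : ℤ, (l : ℤ) = a ^ 2 - 2 * b ^ 2 → 0 < a → (r : ZMod q) ^ 2 = 2 → IsSquare ((a + b * r : ℤ) : ZMod q))))
    (hZ4 : ¬ ((congruentNumberCurve l).analyticRank = 0 ∧ Nat.card ((congruentNumberCurve l).selmerGroup 4) = 2 ^ 4) →
      (∀ a b r : ℤ, (l : ℤ) = a ^ 2 - 2 * b ^ 2 → 0 < a → (r : ZMod q) ^ 2 = 2 → IsSquare ((a + b * r : ℤ) : ZMod q)) →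
      ¬ ∃ y : APoint D.H, IsOfFinAddOrder (D.Z n - (4 : ℤ) • y))
    (hV : (∃ s : ℚ, X = 2 * s ^ 2) ↔
      (¬ ((congruentNumberCurve l).analyticRank = 0 ∧ Nat.card ((congruentNumberCurve l).selmerGroup 4) = 2 ^ 4) ∧
        (∀ a b r : ℤ, (l : ℤ) = a ^ 2 - 2 * b ^ 2 → 0 < a → (r : ZMod q) ^ 2 = 2 → IsSquare ((a + b * r : ℤ) : ZMod q)) ∧
        ¬ ∃ x : ZMod l, x ^ 4 = (q : ZMod l)))
    (hcell : ¬ (¬ ((congruentNumberCurve l).analyticRank = 0 ∧ Nat.card ((congruentNumberCurve l).selmerGroup 4) = 2 ^ 4) ∧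
        (∀ a b r : ℤ, (l : ℤ) = a ^ 2 - 2 * b ^ 2 → 0 < a → (r : ZMod q) ^ 2 = 2 → IsSquare ((a + b * r : ℤ) : ZMod q)) ∧
        ∃ x : ZMod l, x ^ 4 = (q : ZMod l))) :
    ∀ L : ℤ, IsScriptL n L → (2 : ℤ) ∣ L ∧ ¬ (4 : ℤ) ∣ L :=
  levelTwo_R2_of_cellLaws hGZK hmod hCM0 h12 hl hq hl8 hq8 hn hr D hPr hC hBl h hgen hZ hZ4 hV hcell

/-! ## §4 Item 23431 on the whole of R2 from the three laws (LAW Z, LAW V, LAW S), granted 𝔅_ram and the display -/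

/-- ★★ **Item 23431 (`RamifiedJumpOneLevelTwoOfFacts`) restricted to R2, from the three explicit laws.**  Granted the bundle 𝔅_ram of crux 20509
VERBATIM, the display `tyz_genusPointBlockData` ([TianYuanZhang2017] §3, Thm 3.5 at blocks), and — as hypotheses, for abstract symbols `S T` on
pairs of primes — LAW Z (on every display package of every R2 row of analytic rank one), LAW V (for every generator of `A_{lq}(ℚ)/tors`) and LAW S
(«jump-one rows avoid the cell `¬δ ∧ S ∧ T`»): for all primes `l ≡ 1`, `q ≡ 7 (mod 8)` with `(l/q) = 1`, `ord_{s=1} L(E_{lq}, s) = 1`,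
`#Sel₂(E_{lq}) = 2⁵`, `#Sel₄(E_{lq}) = 2⁶`, every integer `L` with `𝓛(lq)² = L²` satisfies `2 ∣ L ∧ 4 ∤ L`.
[cite: TianYuanZhang2017, §3.1, Thm. 3.5, Thm. 1.2] [cite: Wang2016CongruentSha, Thm. 1, Thm. 3] [cite: Darmon2004, Thm. 3.22] -/
theorem levelTwoScriptLExact_R2_of_laws_of_bundle
    (hB : (Literature.NumberTheory.EllipticCurves.rank_eq_analyticRank_of_analyticRank_le_one ∧ WeierstrassCurve.hasEntireLFunction_rat ∧ WeierstrassCurve.bsdRHS_eq_of_isIsogenous ∧ Literature.NumberTheory.EllipticCurves.bsdTriple_of_hasCM_of_L_one_ne_zero ∧ Literature.NumberTheory.EllipticCurves.TianYuanZhang2017.thm12_parity_of_scriptL' ∧ Literature.NumberTheory.EllipticCurves.Tian2014.thm13_rank_one_and_sha_odd ∧ Literature.NumberTheory.QuadraticFields.RedeiReichardt.redeiReichardt_fourTwoCard_classGroup ∧ Literature.NumberTheory.EllipticCurves.LiLiuTian2024.thm12_bsd_congruentNumberCurve ∧ Literature.NumberTheory.EllipticCurves.Monsky1990.cor515_rank_eq_one_and_card_selmerGroup_two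 ∧ Literature.NumberTheory.EllipticCurves.HeathBrown1994.monsky_card_selmerGroup_two_even ∧ Literature.NumberTheory.EllipticCurves.Tian2014.tian2014_system_sMinus_genus))
    (hT : tyz_genusPointBlockData)
    (S T : ℕ → ℕ → Prop)
    (hLawZ : ∀ (l q : ℕ), l.Prime → q.Prime → l % 8 = 1 → q % 8 = 7 → IsSquare ((l : ℤ) : ZMod q) →
      (congruentNumberCurve (l * q)).analyticRank = 1 →
      ∀ D : GenusPointData (l * q), D.Printed → D.CMPointCompositumPrinted → D.Thm35AtBlocks →
        ((∃ y : APoint D.H, IsOfFinAddOrder (D.Z (l * q) - (2 : ℤ) • y)) ↔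
          (¬ ((congruentNumberCurve l).analyticRank = 0 ∧ Nat.card ((congruentNumberCurve l).selmerGroup 4) = 2 ^ 4) ∧ S l q)) ∧
        (¬ ((congruentNumberCurve l).analyticRank = 0 ∧ Nat.card ((congruentNumberCurve l).selmerGroup 4) = 2 ^ 4) → S l q →
          ¬ ∃ y : APoint D.H, IsOfFinAddOrder (D.Z (l * q) - (4 : ℤ) • y)))
    (hLawV : ∀ (l q : ℕ), l.Prime → q.Prime → l % 8 = 1 → q % 8 = 7 → IsSquare ((l : ℤ) : ZMod q) →
      (congruentNumberCurve (l * q)).analyticRank = 1 →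
      ∀ {X Y : ℚ} (h : (Atwo (l * q)).toAffine.Nonsingular X Y),
        (∀ P : (Atwo (l * q)).toAffine.Point, ∃ m : ℤ, IsOfFinAddOrder (P - m • (Point.some X Y h : (Atwo (l * q)).toAffine.Point))) →
        ((∃ s : ℚ, X = 2 * s ^ 2) ↔
          (¬ ((congruentNumberCurve l).analyticRank = 0 ∧ Nat.card ((congruentNumberCurve l).selmerGroup 4) = 2 ^ 4) ∧ S l q ∧ ¬ T l q)))
    (hLawS : ∀ (l q : ℕ), l.Prime → q.Prime → l % 8 = 1 → q % 8 = 7 → IsSquare ((l : ℤ) : ZMod q) →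
      (congruentNumberCurve (l * q)).analyticRank = 1 →
      Nat.card ((congruentNumberCurve (l * q)).selmerGroup 2) = 2 ^ 5 → Nat.card ((congruentNumberCurve (l * q)).selmerGroup 4) = 2 ^ 6 →
        ¬ (¬ ((congruentNumberCurve l).analyticRank = 0 ∧ Nat.card ((congruentNumberCurve l).selmerGroup 4) = 2 ^ 4) ∧ S l q ∧ T l q))
    {l q : ℕ} (hl : l.Prime) (hq : q.Prime) (hl8 : l % 8 = 1) (hq8 : q % 8 = 7) (hlq : IsSquare ((l : ℤ) : ZMod q))
    (hr : (congruentNumberCurve (l * q)).analyticRank = 1)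
    (h₂ : Nat.card ((congruentNumberCurve (l * q)).selmerGroup 2) = 2 ^ 5)
    (h₄ : Nat.card ((congruentNumberCurve (l * q)).selmerGroup 4) = 2 ^ 6) :
    ∀ L : ℤ, IsScriptL (l * q) L → (2 : ℤ) ∣ L ∧ ¬ (4 : ℤ) ∣ L := by
  obtain ⟨hsq, h7, -⟩ := sector_R2 hl hq hl8 hq8 (rfl : l * q = l * q)
  obtain ⟨D, hPr, hC, hBl⟩ := hT (l * q) hsq (Or.inr (Or.inr h7))
  obtain ⟨X, Y, h, hgen⟩ := exists_atwo_generator hB.1 hsq hr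
  obtain ⟨hZ, hZ4⟩ := hLawZ l q hl hq hl8 hq8 hlq hr D hPr hC hBl
  exact levelTwo_R2_of_cellLaws hB.1 hB.2.1 hB.2.2.2.1 hB.2.2.2.2.1 hl hq hl8 hq8 rfl hr D hPr hC hBl h hgen hZ hZ4
    (hLawV l q hl hq hl8 hq8 hlq hr h hgen) (hLawS l q hl hq hl8 hq8 hlq hr h₂ h₄)


/-! ## §5 (rev 2, same cycle) THE EXACT-DEPTH CLAUSE BELONGS TO THE JUMP-ONE CELL ONLY — corrected laws

The out-of-sample run of the FULL instrument (`r2full.py` over g17's `zfull.py`, 17 fresh rows `2·10⁴ < n < 4·10⁴`, all cells) confirms every cell of the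
census table — and refines one clause: in the cell `¬δ(l) ∧ S ∧ T` (where `v₂(𝓛(lq)) = 2`, 9/9 rows, so the row is NOT jump-one) the genus period can
have depth TWO (`n = 25871 = 41·631`, `n = 32239 = 313·103`: `Z ∈ 4A(ℍ′) + tors`), while on the jump-one cell `¬δ ∧ S ∧ ¬T` its depth is exactly one
(16/16 in sample, 5/5 fresh).  Hence the exact-depth half of LAW Z must carry `¬T`: «`¬δ(l) ∧ S ∧ ¬T ⟹ Z(lq) ∉ 4A(ℍ′) + tors`».  The hypotheses `hZ4` /
`hLawZ` of §§2–4 omit `¬T`; as GLOBAL statements over R2 they are refuted by `n = 25871` (so §4, while true, has an unsatisfiable hypothesis as far as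
the instrument can tell).  The primed theorems below are the ones whose hypotheses are the census laws VERBATIM; the proofs are unchanged (the
exact-depth clause is only used on the invisible branch, where `¬T` is available).  Corrected cell table (122 in-sample + 64 fresh decided rows,
0 exceptions): `δ` → (ρ=1, depth Z=0, v₂𝓛=1); `¬δ ∧ ¬S` → (ρ=0, visible, depth Z=0, v₂𝓛=1); `¬δ ∧ S ∧ ¬T` → (ρ=0, invisible, depth Z=1, v₂𝓛=1);
`¬δ ∧ S ∧ T` → (v₂𝓛 = 2, depth Z ∈ {1,2}, generator class mixed). -/

/-- ★ **C⁺ at a row of R2 from the pointwise laws, corrected exact-depth clause** (`¬δ(l) → S → ¬T → Z(lq) ∉ 4A(ℍ′)+tors`); otherwise as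
`levelTwo_R2_of_cellLaws`. [cite: TianYuanZhang2017, §3.1, Thm. 3.5, Lemma 3.18] [cite: Darmon2004, Thm. 3.22] [cite: BurungaleFlach2024, Thm 1.1 / Cor. 3] -/
theorem levelTwo_R2_of_cellLaws' (hGZK : rank_eq_analyticRank_of_analyticRank_le_one)
    (hmod : WeierstrassCurve.hasEntireLFunction_rat) (hCM0 : bsdTriple_of_hasCM_of_L_one_ne_zero) (h12 : thm12_parity_of_scriptL')
    {l q : ℕ} (hl : l.Prime) (hq : q.Prime) (hl8 : l % 8 = 1) (hq8 : q % 8 = 7) (hn : n = l * q)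
    (hr : (congruentNumberCurve n).analyticRank = 1)
    (D : GenusPointData n) (hPr : D.Printed) (hC : D.CMPointCompositumPrinted) (hBl : D.Thm35AtBlocks)
    {X Y : ℚ} (h : (Atwo n).toAffine.Nonsingular X Y)
    (hgen : ∀ P : (Atwo n).toAffine.Point, ∃ m : ℤ, IsOfFinAddOrder (P - m • (Point.some X Y h : (Atwo n).toAffine.Point)))
    {S T : Prop}
    (hZ : (∃ y : APoint D.H, IsOfFinAddOrder (D.Z n - (2 : ℤ) • y)) ↔
      (¬ ((congruentNumberCurve l).analyticRank = 0 ∧ Nat.card ((congruentNumberCurve l).selmerGroup 4) = 2 ^ 4) ∧ S))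
    (hZ4 : ¬ ((congruentNumberCurve l).analyticRank = 0 ∧ Nat.card ((congruentNumberCurve l).selmerGroup 4) = 2 ^ 4) → S → ¬ T →
      ¬ ∃ y : APoint D.H, IsOfFinAddOrder (D.Z n - (4 : ℤ) • y))
    (hV : (∃ s : ℚ, X = 2 * s ^ 2) ↔
      (¬ ((congruentNumberCurve l).analyticRank = 0 ∧ Nat.card ((congruentNumberCurve l).selmerGroup 4) = 2 ^ 4) ∧ S ∧ ¬ T))
    (hcell : ¬ (¬ ((congruentNumberCurve l).analyticRank = 0 ∧ Nat.card ((congruentNumberCurve l).selmerGroup 4) = 2 ^ 4) ∧ S ∧ T)) :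
    ∀ L : ℤ, IsScriptL n L → (2 : ℤ) ∣ L ∧ ¬ (4 : ℤ) ∣ L := by
  by_cases hδ : ((congruentNumberCurve l).analyticRank = 0 ∧ Nat.card ((congruentNumberCurve l).selmerGroup 4) = 2 ^ 4)
  · obtain ⟨α, hα, -⟩ := exists_generatesFreePart_prime hGZK h12 hq (Or.inr hq8)
    refine (levelTwo_iff_genusPeriod_R2_delta hGZK hmod hCM0 h12 hl hq hl8 hq8 hn hr D hPr hC hBl h hgen α hα hδ).mpr
      (Or.inr ⟨?_, ?_⟩)
    · intro hX; exact (hV.mp hX).1 hδ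
    · intro h2; exact (hZ.mp h2).1 hδ
  · by_cases hS : S
    · have hT : ¬ T := fun hT => hcell ⟨hδ, hS, hT⟩
      exact (levelTwo_iff_genusPeriod_R2 hGZK hmod hCM0 h12 hl hq hl8 hq8 hn hr D hPr hC hBl h hgen hδ).mpr
        (Or.inl ⟨hV.mpr ⟨hδ, hS, hT⟩, hZ.mpr ⟨hδ, hS⟩, hZ4 hδ hS hT⟩)
    · exact (levelTwo_iff_genusPeriod_R2 hGZK hmod hCM0 h12 hl hq hl8 hq8 hn hr D hPr hC hBl h hgen hδ).mpr
        (Or.inr ⟨fun hX => hS (hV.mp hX).2.1, fun h2 => hS (hZ.mp h2).2⟩)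

/-- ★★ **C⁺ at a row of R2 from the EXPLICIT Rédei laws, corrected exact-depth clause** (`S` = `[2,l,q] = +1`, `T` = `(q/l)₄ = +1`, spelled inline as in
`levelTwo_R2_of_redeiLaws`). [cite: TianYuanZhang2017, §3.1, Thm. 3.5] [cite: Wang2016CongruentSha, Thm. 3] [cite: Darmon2004, Thm. 3.22] -/
theorem levelTwo_R2_of_redeiLaws' (hGZK : rank_eq_analyticRank_of_analyticRank_le_one)
    (hmod : WeierstrassCurve.hasEntireLFunction_rat) (hCM0 : bsdTriple_of_hasCM_of_L_one_ne_zero) (h12 : thm12_parity_of_scriptL')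
    {l q : ℕ} (hl : l.Prime) (hq : q.Prime) (hl8 : l % 8 = 1) (hq8 : q % 8 = 7) (hn : n = l * q)
    (hr : (congruentNumberCurve n).analyticRank = 1)
    (D : GenusPointData n) (hPr : D.Printed) (hC : D.CMPointCompositumPrinted) (hBl : D.Thm35AtBlocks)
    {X Y : ℚ} (h : (Atwo n).toAffine.Nonsingular X Y)
    (hgen : ∀ P : (Atwo n).toAffine.Point, ∃ m : ℤ, IsOfFinAddOrder (P - m • (Point.some X Y h : (Atwo n).toAffine.Point)))
    (hZ : (∃ y : APoint D.H, IsOfFinAddOrder (D.Z n - (2 : ℤ) • y)) ↔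
      (¬ ((congruentNumberCurve l).analyticRank = 0 ∧ Nat.card ((congruentNumberCurve l).selmerGroup 4) = 2 ^ 4) ∧
        (∀ a b r : ℤ, (l : ℤ) = a ^ 2 - 2 * b ^ 2 → 0 < a → (r : ZMod q) ^ 2 = 2 → IsSquare ((a + b * r : ℤ) : ZMod q))))
    (hZ4 : ¬ ((congruentNumberCurve l).analyticRank = 0 ∧ Nat.card ((congruentNumberCurve l).selmerGroup 4) = 2 ^ 4) →
      (∀ a b r : ℤ, (l : ℤ) = a ^ 2 - 2 * b ^ 2 → 0 < a → (r : ZMod q) ^ 2 = 2 → IsSquare ((a + b * r : ℤ) : ZMod q)) →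
      (¬ ∃ x : ZMod l, x ^ 4 = (q : ZMod l)) →
      ¬ ∃ y : APoint D.H, IsOfFinAddOrder (D.Z n - (4 : ℤ) • y))
    (hV : (∃ s : ℚ, X = 2 * s ^ 2) ↔
      (¬ ((congruentNumberCurve l).analyticRank = 0 ∧ Nat.card ((congruentNumberCurve l).selmerGroup 4) = 2 ^ 4) ∧
        (∀ a b r : ℤ, (l : ℤ) = a ^ 2 - 2 * b ^ 2 → 0 < a → (r : ZMod q) ^ 2 = 2 → IsSquare ((a + b * r : ℤ) : ZMod q)) ∧
        ¬ ∃ x : ZMod l, x ^ 4 = (q : ZMod l)))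
    (hcell : ¬ (¬ ((congruentNumberCurve l).analyticRank = 0 ∧ Nat.card ((congruentNumberCurve l).selmerGroup 4) = 2 ^ 4) ∧
        (∀ a b r : ℤ, (l : ℤ) = a ^ 2 - 2 * b ^ 2 → 0 < a → (r : ZMod q) ^ 2 = 2 → IsSquare ((a + b * r : ℤ) : ZMod q)) ∧
        ∃ x : ZMod l, x ^ 4 = (q : ZMod l))) :
    ∀ L : ℤ, IsScriptL n L → (2 : ℤ) ∣ L ∧ ¬ (4 : ℤ) ∣ L :=
  levelTwo_R2_of_cellLaws' hGZK hmod hCM0 h12 hl hq hl8 hq8 hn hr D hPr hC hBl h hgen hZ hZ4 hV hcell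

/-- ★★ **Item 23431 restricted to R2 from the three laws, corrected exact-depth clause** (LAW Z's second half reads `¬δ → S → ¬T → Z ∉ 4A + tors`);
otherwise as `levelTwoScriptLExact_R2_of_laws_of_bundle` — 𝔅_ram VERBATIM + the display `tyz_genusPointBlockData` + LAW Z / LAW V / LAW S over R2.
[cite: TianYuanZhang2017, §3.1, Thm. 3.5, Thm. 1.2] [cite: Wang2016CongruentSha, Thm. 1, Thm. 3] [cite: Darmon2004, Thm. 3.22] -/
theorem levelTwoScriptLExact_R2_of_laws_of_bundle'
    (hB : (Literature.NumberTheory.EllipticCurves.rank_eq_analyticRank_of_analyticRank_le_one ∧ WeierstrassCurve.hasEntireLFunction_rat ∧ WeierstrassCurve.bsdRHS_eq_of_isIsogenous ∧ Literature.NumberTheory.EllipticCurves.bsdTriple_of_hasCM_of_L_one_ne_zero ∧ Literature.NumberTheory.EllipticCurves.TianYuanZhang2017.thm12_parity_of_scriptL' ∧ Literature.NumberTheory.EllipticCurves.Tian2014.thm13_rank_one_and_sha_odd ∧ Literature.NumberTheory.QuadraticFields.RedeiReichardt.redeiReichardt_fourTwoCard_classGroup ∧ Literature.NumberTheory.EllipticCurves.LiLiuTian2024.thm12_bsd_congruentNumberCurve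 ∧ Literature.NumberTheory.EllipticCurves.Monsky1990.cor515_rank_eq_one_and_card_selmerGroup_two ∧ Literature.NumberTheory.EllipticCurves.HeathBrown1994.monsky_card_selmerGroup_two_even ∧ Literature.NumberTheory.EllipticCurves.Tian2014.tian2014_system_sMinus_genus))
    (hT : tyz_genusPointBlockData)
    (S T : ℕ → ℕ → Prop)
    (hLawZ : ∀ (l q : ℕ), l.Prime → q.Prime → l % 8 = 1 → q % 8 = 7 → IsSquare ((l : ℤ) : ZMod q) →
      (congruentNumberCurve (l * q)).analyticRank = 1 →
      ∀ D : GenusPointData (l * q), D.Printed → D.CMPointCompositumPrinted → D.Thm35AtBlocks →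
        ((∃ y : APoint D.H, IsOfFinAddOrder (D.Z (l * q) - (2 : ℤ) • y)) ↔
          (¬ ((congruentNumberCurve l).analyticRank = 0 ∧ Nat.card ((congruentNumberCurve l).selmerGroup 4) = 2 ^ 4) ∧ S l q)) ∧
        (¬ ((congruentNumberCurve l).analyticRank = 0 ∧ Nat.card ((congruentNumberCurve l).selmerGroup 4) = 2 ^ 4) → S l q → ¬ T l q →
          ¬ ∃ y : APoint D.H, IsOfFinAddOrder (D.Z (l * q) - (4 : ℤ) • y)))
    (hLawV : ∀ (l q : ℕ), l.Prime → q.Prime → l % 8 = 1 → q % 8 = 7 → IsSquare ((l : ℤ) : ZMod q) →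
      (congruentNumberCurve (l * q)).analyticRank = 1 →
      ∀ {X Y : ℚ} (h : (Atwo (l * q)).toAffine.Nonsingular X Y),
        (∀ P : (Atwo (l * q)).toAffine.Point, ∃ m : ℤ, IsOfFinAddOrder (P - m • (Point.some X Y h : (Atwo (l * q)).toAffine.Point))) →
        ((∃ s : ℚ, X = 2 * s ^ 2) ↔
          (¬ ((congruentNumberCurve l).analyticRank = 0 ∧ Nat.card ((congruentNumberCurve l).selmerGroup 4) = 2 ^ 4) ∧ S l q ∧ ¬ T l q)))
    (hLawS : ∀ (l q : ℕ), l.Prime → q.Prime → l % 8 = 1 → q % 8 = 7 → IsSquare ((l : ℤ) : ZMod q) →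
      (congruentNumberCurve (l * q)).analyticRank = 1 →
      Nat.card ((congruentNumberCurve (l * q)).selmerGroup 2) = 2 ^ 5 → Nat.card ((congruentNumberCurve (l * q)).selmerGroup 4) = 2 ^ 6 →
        ¬ (¬ ((congruentNumberCurve l).analyticRank = 0 ∧ Nat.card ((congruentNumberCurve l).selmerGroup 4) = 2 ^ 4) ∧ S l q ∧ T l q))
    {l q : ℕ} (hl : l.Prime) (hq : q.Prime) (hl8 : l % 8 = 1) (hq8 : q % 8 = 7) (hlq : IsSquare ((l : ℤ) : ZMod q))
    (hr : (congruentNumberCurve (l * q)).analyticRank = 1)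
    (h₂ : Nat.card ((congruentNumberCurve (l * q)).selmerGroup 2) = 2 ^ 5)
    (h₄ : Nat.card ((congruentNumberCurve (l * q)).selmerGroup 4) = 2 ^ 6) :
    ∀ L : ℤ, IsScriptL (l * q) L → (2 : ℤ) ∣ L ∧ ¬ (4 : ℤ) ∣ L := by
  obtain ⟨hsq, h7, -⟩ := sector_R2 hl hq hl8 hq8 (rfl : l * q = l * q)
  obtain ⟨D, hPr, hC, hBl⟩ := hT (l * q) hsq (Or.inr (Or.inr h7))
  obtain ⟨X, Y, h, hgen⟩ := exists_atwo_generator hB.1 hsq hr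
  obtain ⟨hZ, hZ4⟩ := hLawZ l q hl hq hl8 hq8 hlq hr D hPr hC hBl
  exact levelTwo_R2_of_cellLaws' hB.1 hB.2.1 hB.2.2.2.1 hB.2.2.2.2.1 hl hq hl8 hq8 rfl hr D hPr hC hBl h hgen hZ hZ4
    (hLawV l q hl hq hl8 hq8 hlq hr h hgen) (hLawS l q hl hq hl8 hq8 hlq hr h₂ h₄)

end Summit.BirchSwinnertonDyer.PrintCf2.RedeiCellsR2

end
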